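import Literature.Geometry.Riemannian.HeatKernelExponentialMoment
import Literature.Geometry.Riemannian.RicciFlowHeatKernelFn
import Literature.Geometry.Riemannian.NashEntropy
import HarnessLib

/-!
# The tail part of the bootstrap in Bamler's heat kernel upper bound
# (Bamler 2020a, §7.2, proof of Thm. 7.1, display (7.13))

R. Bamler, *Entropy and heat kernel bounds on a Ricci flow background*, arXiv:2008.07093 (2020a),
§7.2. In the proof of the Gaussian upper bound for the heat kernel (Thm. 7.1) one bootstraps an
a priori bound `K(·, t₁; y, s) ≤ Z τ₁^{-n/2} exp(−𝒩*_s(·, t₁))` through the reproduction formula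
`K(x, t; y, s) = ∫ K(·, t₁; y, s) dν_{x,t;t₁}`. Display (7.13) controls the contribution of the
complement of the ball `B = B(z₁, t₁, √(A H_n) ρ √τ)` around an `H_n`-centre `(z₁, t₁)` of
`(x, t)`, `t = s + τ`, `t₁ = s + (1 − ρ²)τ`:

  `∫_{M ∖ B} K(·, t₁; y, s) dν_{x,t;t₁} ≤ C(A, ρ, L, …) Z τ^{-n/2} exp(−𝒩*_s(x, t))`,

with a constant that is small when `A` is large.

This file proves this tail estimate (`setIntegral_heatKernelFn_compl_ball_le`) for a Ricci flow
`hflow = (h, cov)` on `[a, T]` of a `C^∞` family of Riemannian metrics on a closed connected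
manifold `M` modelled on `ℝᵐ`, in terms of the tree's heat kernel function
`IsRicciFlow.heatKernelFn` (`RicciFlowHeatKernelFn.lean`), heat kernel measures
`heatKernelMeasure` (`HeatKernelMeasures.lean`), Riemannian distance `(h t₁).edist (hR t₁)` and
pointed Nash entropy `pointedNashEntropy` (`NashEntropy.lean`). The two analytic inputs of
Bamler's argument enter as HYPOTHESES: the a priori bound at time `t₁` (hypothesis `hZ`) and the
entropy comparison `𝒩*_s(x, t) − 𝒩*_s(w, t₁) ≤ c + L d_{t₁}(z₁, w)` (hypothesis `hEC`, Bamler's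
(7.7)/(7.9)); the variance bound `Var ≤ H_m (t − t₁)` of the centre is hypothesis `hvar`. With
these, pointwise `K(w, t₁; y, s) ≤ Z₁ ((1 − ρ²)τ)^{-m/2} e^{c} e^{−𝒩*_s(x,t)} e^{L d(w)}`, and the
tail integral of `e^{L d}` is bounded by the AM–GM (Cauchy–Schwarz) splitting
`e^{L d} ≤ λ/2 + e^{2 L d}/(2λ)`, Chebyshev's inequality `ν(M ∖ B) ≤ 1/A` for the variance bound,
and the exponential moment bound `∫ e^{2 L d} dν ≤ 3 exp(32 L²ρ²τ + 2L√(2 H_m) ρ √τ)`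
(`integral_exp_mul_edist_heatKernelMeasure_le`, `HeatKernelExponentialMoment.lean`), with the
optimal `λ`; this replaces Bamler's trick `e^x ≤ 1 + ρ e^{x/ρ}` and gives the constant
`(1 − ρ²)^{-m/2} e^{c} √(3/A) exp(16 (Lρ√τ)² + √(2 H_m) Lρ√τ)`.

Everything is proved; no definitions, no named facts. What is NOT here: the ball part (7.10)–
(7.12) of the bootstrap, the gradient step (7.6)–(7.8), the entropy comparison (7.7)/(7.9) itself,
the existence of `H_n`-centres (Prop. 3.13), and the assembled Thm. 7.1.

## References

* R. H. Bamler, *Entropy and heat kernel bounds on a Ricci flow background*, arXiv:2008.07093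
  (2020), §7.2, proof of Thm. 7.1, (7.13). [Bamler2020Entropy]
-/

noncomputable section

open Bundle Set Function Filter Manifold MeasureTheory Measure TopologicalSpace
open scoped Manifold ContDiff Topology ENNReal NNReal

namespace Literature.Geometry.Riemannian

open Lorentzian Lorentzian.PseudoRiemannianMetric

section BootstrapTail

/-- The optimal AM–GM constant: if `A p² = 3` then `(A p e)/(2A) + 3e²/(2 A p e) = p e`.
[folklore] -/
private theorem tail_amgm_const {A p e : ℝ} (hA : A ≠ 0) (hp : p ≠ 0) (he : e ≠ 0)
    (hp2 : A * p ^ 2 = 3) :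
    A * p * e / 2 * (1 / A) + 1 / (2 * (A * p * e)) * (3 * e ^ 2) = p * e := by
  rw [← hp2]
  field_simp
  ring

/-- AM–GM in the form `q ≤ λ/2 + q²/(2λ)` for `λ > 0`. [folklore] -/
private theorem le_half_add_sq_div {q lam : ℝ} (hlam : 0 < lam) :
    q ≤ lam / 2 + q ^ 2 / (2 * lam) := by
  rw [div_add_div _ _ two_ne_zero (by positivity), le_div_iff₀ (by positivity)]
  nlinarith [sq_nonneg (q - lam)]

/-- **The tail part of the bootstrap in Bamler's heat kernel upper bound** (Bamler 2020a, §7.2,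
proof of Thm. 7.1, display (7.13)). Let `(h, cov)` be a Ricci flow on `[a, T]` of a smooth
family of Riemannian metrics on a closed connected manifold `M` modelled on `ℝᵐ` (`m ≥ 1`),
`a < s`, `0 < τ`, `t = s + τ ≤ T`, `0 < ρ ≤ 1/2`, `t₁ = s + (1 − ρ²)τ`, `H_m = (m − 1)π²/2 + 4`,
`ν = ν_{x,t;t₁}`, `u(w) = K(w, t₁; y, s)`, `d(w) = d_{t₁}(z₁, w)`, and assume
* (centre) `∫ d² dν ≤ H_m (t − t₁)`,
* (a priori bound) `u(w) ≤ Z₁ ((1 − ρ²)τ)^{-m/2} exp(−𝒩*_s(w, t₁))` for all `w`,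
* (entropy comparison) `𝒩*_s(x, t) − 𝒩*_s(w, t₁) ≤ c + L d(w)` for all `w`,
with `A ≥ 2`, `Z₁, L, c ≥ 0` (the hypothesis `0 ≤ c` is not used). Then

  `∫_{d ≥ √(A H_m) ρ √τ} u dν`
  `  ≤ (1 − ρ²)^{-m/2} e^{c} √(3/A) exp(16 (Lρ√τ)² + √(2 H_m) Lρ√τ) Z₁ τ^{-m/2} exp(−𝒩*_s(x, t))`.

Proof: pointwise `u ≤ Z₁ ((1 − ρ²)τ)^{-m/2} e^{c} e^{−𝒩*_s(x,t)} e^{L d}`; then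
`e^{L d} ≤ λ/2 + e^{2Ld}/(2λ)`, Chebyshev `ν{d ≥ √(A H_m) ρ √τ} ≤ H_m ρ²τ/(A H_m ρ²τ) = 1/A`,
the exponential moment bound `∫ e^{2Ld} dν ≤ 3 e^{2E}`, `E = 16 (Lρ√τ)² + √(2 H_m) Lρ√τ`
(`integral_exp_mul_edist_heatKernelMeasure_le`), and `λ = A √(3/A) e^{E}`.
[cite: Bamler2020Entropy, §7.2, proof of Thm. 7.1, (7.13)] -/
theorem setIntegral_heatKernelFn_compl_ball_le {m : ℕ} {H : Type*} [TopologicalSpace H]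
    {I : ModelWithCorners ℝ (EuclideanSpace ℝ (Fin m)) H} [I.Boundaryless]
    {M : Type*} [TopologicalSpace M] [ChartedSpace H M] [IsManifold I ∞ M]
    [T2Space M] [CompactSpace M] [SecondCountableTopology M] [MeasurableSpace M] [BorelSpace M]
    [ConnectedSpace M]
    {h : ℝ → PseudoRiemannianMetric I ∞ (EuclideanSpace ℝ (Fin m)) (TangentSpace I : M → Type _)}
    {cov : ℝ → CovariantDerivative I (EuclideanSpace ℝ (Fin m)) (TangentSpace I : M → Type _)}
    {a T : ℝ} (hflow : IsRicciFlow h cov (Icc a T)) (hh : IsContMDiffFamilyOn ∞ h univ)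
    (hR : ∀ r, (h r).IsRiemannian) (hm : 0 < m) {s τ ρ : ℝ} (has : a < s) (hτ : 0 < τ)
    (hT : s + τ ≤ T) (hρ : 0 < ρ) (hρ2 : ρ ≤ 1 / 2) (y x z₁ : M) {A Z₁ L c : ℝ} (hA : 2 ≤ A)
    (hZ₁ : 0 ≤ Z₁) (hL : 0 ≤ L) (_hc : 0 ≤ c)
    (hvar : ∫⁻ w, (h (s + (1 - ρ ^ 2) * τ)).edist (hR (s + (1 - ρ ^ 2) * τ)) z₁ w ^ 2
        ∂(heatKernelMeasure hh hR (s + τ) x (s + (1 - ρ ^ 2) * τ)) ≤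
      ENNReal.ofReal ((((m : ℝ) - 1) * Real.pi ^ 2 / 2 + 4) * (s + τ - (s + (1 - ρ ^ 2) * τ))))
    (hZ : ∀ w : M, hflow.heatKernelFn hh hR (s + (1 - ρ ^ 2) * τ) w (y, s) ≤
      Z₁ * ((1 - ρ ^ 2) * τ) ^ (-(m : ℝ) / 2) * Real.exp (-(pointedNashEntropy h
        (fun r v ↦ hflow.heatKernelFn hh hR (s + (1 - ρ ^ 2) * τ) w (v, r)) m
        (s + (1 - ρ ^ 2) * τ) s)))
    (hEC : ∀ w : M, pointedNashEntropy h (fun r v ↦ hflow.heatKernelFn hh hR (s + τ) x (v, r)) m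
          (s + τ) s -
        pointedNashEntropy h (fun r v ↦ hflow.heatKernelFn hh hR (s + (1 - ρ ^ 2) * τ) w (v, r))
          m (s + (1 - ρ ^ 2) * τ) s ≤
      c + L * ((h (s + (1 - ρ ^ 2) * τ)).edist (hR (s + (1 - ρ ^ 2) * τ)) z₁ w).toReal) :
    ∫ w in {w | ENNReal.ofReal (Real.sqrt (A * (((m : ℝ) - 1) * Real.pi ^ 2 / 2 + 4)) * ρ *
        Real.sqrt τ) ≤ (h (s + (1 - ρ ^ 2) * τ)).edist (hR (s + (1 - ρ ^ 2) * τ)) z₁ w},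
        hflow.heatKernelFn hh hR (s + (1 - ρ ^ 2) * τ) w (y, s)
        ∂(heatKernelMeasure hh hR (s + τ) x (s + (1 - ρ ^ 2) * τ)) ≤
      (1 - ρ ^ 2) ^ (-(m : ℝ) / 2) * Real.exp c * Real.sqrt (3 / A) *
          Real.exp (16 * (L * ρ * Real.sqrt τ) ^ 2 +
            Real.sqrt (2 * (((m : ℝ) - 1) * Real.pi ^ 2 / 2 + 4)) * (L * ρ * Real.sqrt τ)) *
        Z₁ * τ ^ (-(m : ℝ) / 2) * Real.exp (-(pointedNashEntropy h
          (fun r v ↦ hflow.heatKernelFn hh hR (s + τ) x (v, r)) m (s + τ) s)) := by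
  -- elementary facts on the parameters
  have hρ21 : ρ ^ 2 ≤ 1 / 4 := by nlinarith
  have h1ρ : 0 < 1 - ρ ^ 2 := by linarith
  have hA0 : 0 < A := by linarith
  have hAne : A ≠ 0 := hA0.ne'
  have hm1 : (1 : ℝ) ≤ m := by exact_mod_cast hm
  -- the times `t = s + τ` and `t₁ = s + (1 - ρ²) τ`
  set t : ℝ := s + τ with ht
  set t₁ : ℝ := s + (1 - ρ ^ 2) * τ with ht₁
  have htt₁ : t - t₁ = ρ ^ 2 * τ := by rw [ht, ht₁]; ring
  have hst₁ : s < t₁ := by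
    rw [ht₁]
    exact lt_add_of_pos_right s (mul_pos h1ρ hτ)
  have ht₁t : t₁ < t := by
    have := mul_pos (pow_pos hρ 2) hτ
    linarith
  have hat₁ : a < t₁ := has.trans hst₁
  have ht₁I : t₁ ∈ Ioc a T := ⟨hat₁, ht₁t.le.trans hT⟩
  have hsI : s ∈ Ioo a t₁ := ⟨has, hst₁⟩
  -- the exponential moment bound with `κ = 2L` (Bamler 2020a, §7.2 / Hein–Naber)
  have hmom₀ := integral_exp_mul_edist_heatKernelMeasure_le hflow hh hR hm hat₁ ht₁t hT x z₁ hvar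
    (κ := 2 * L) (by positivity)
  -- abbreviations
  set ν : Measure M := heatKernelMeasure hh hR t x t₁ with hν
  set Hm : ℝ := ((m : ℝ) - 1) * Real.pi ^ 2 / 2 + 4 with hHm
  set Nx : ℝ := pointedNashEntropy h (fun r v ↦ hflow.heatKernelFn hh hR t x (v, r)) m t s
    with hNx
  set E : ℝ := 16 * (L * ρ * Real.sqrt τ) ^ 2 + Real.sqrt (2 * Hm) * (L * ρ * Real.sqrt τ)
    with hE
  set p : ℝ := Real.sqrt (3 / A) with hp_def
  set r₀ : ℝ := Real.sqrt (A * Hm) * ρ * Real.sqrt τ with hr₀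
  set S : Set M := {w | ENNReal.ofReal r₀ ≤ (h t₁).edist (hR t₁) z₁ w} with hS
  have hHm0 : 0 < Hm := by
    have h1 : (0 : ℝ) ≤ ((m : ℝ) - 1) * Real.pi ^ 2 / 2 :=
      div_nonneg (mul_nonneg (by linarith) (sq_nonneg _)) zero_le_two
    rw [hHm]
    linarith
  have hV0 : 0 < Hm * (t - t₁) := by rw [htt₁]; positivity
  have hp : 0 < p := Real.sqrt_pos.2 (by positivity)
  have hp2 : A * p ^ 2 = 3 := by
    rw [hp_def, Real.sq_sqrt (by positivity : (0 : ℝ) ≤ 3 / A)]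
    field_simp
  have hr₀0 : 0 ≤ r₀ := by positivity
  have hr₀2 : r₀ ^ 2 = A * (Hm * (t - t₁)) := by
    rw [hr₀, htt₁]
    simp only [mul_pow, Real.sq_sqrt hτ.le, Real.sq_sqrt (by positivity : (0 : ℝ) ≤ A * Hm)]
    ring
  -- the kernel `u = K(·, t₁; y, s)` is positive; the distance `d = d_{t₁}(z₁, ·)` is continuous
  have hupos : ∀ w, 0 < hflow.heatKernelFn hh hR t₁ w (y, s) := fun w ↦
    hflow.heatKernelFn_pos hh hR ht₁I w ⟨mem_univ _, hsI⟩
  have hcont : Continuous fun w ↦ (h t₁).edist (hR t₁) z₁ w :=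
    ((h t₁).continuous_edist (hR t₁)).comp (.prodMk_right z₁)
  have hfin : ∀ w, (h t₁).edist (hR t₁) z₁ w ≠ ⊤ := fun w ↦
    PseudoRiemannianMetric.edist_ne_top (hR t₁) z₁ w
  set d : M → ℝ := fun w ↦ ((h t₁).edist (hR t₁) z₁ w).toReal with hd
  have hdc : Continuous d := continuous_iff_continuousAt.2 fun w ↦
    (ENNReal.tendsto_toReal (hfin w)).comp (hcont.tendsto w)
  have hde : Continuous fun w ↦ Real.exp (L * d w) :=
    Real.continuous_exp.comp (continuous_const.mul hdc)
  have hde2 : Continuous fun w ↦ Real.exp (2 * L * d w) :=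
    Real.continuous_exp.comp (continuous_const.mul hdc)
  have hint : ∀ {f : M → ℝ}, Continuous f → Integrable f ν := fun hf ↦
    hf.integrable_of_hasCompactSupport (HasCompactSupport.of_compactSpace _)
  -- Step 1: the pointwise bound `u ≤ C₀ e^{L d}`
  set C₀ : ℝ := Z₁ * ((1 - ρ ^ 2) * τ) ^ (-(m : ℝ) / 2) * (Real.exp c * Real.exp (-Nx)) with hC₀
  have hC₀0 : 0 ≤ C₀ := by rw [hC₀]; positivity
  have hpt : ∀ w, hflow.heatKernelFn hh hR t₁ w (y, s) ≤ C₀ * Real.exp (L * d w) := by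
    intro w
    have h2 := hEC w
    have h3 : Real.exp (-(pointedNashEntropy h
        (fun r v ↦ hflow.heatKernelFn hh hR t₁ w (v, r)) m t₁ s)) ≤
        Real.exp c * Real.exp (-Nx) * Real.exp (L * d w) := by
      rw [← Real.exp_add, ← Real.exp_add]
      refine Real.exp_le_exp.2 ?_
      simp only [hd]
      linarith
    calc hflow.heatKernelFn hh hR t₁ w (y, s) ≤ _ := hZ w
      _ ≤ Z₁ * ((1 - ρ ^ 2) * τ) ^ (-(m : ℝ) / 2) *
            (Real.exp c * Real.exp (-Nx) * Real.exp (L * d w)) :=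
          mul_le_mul_of_nonneg_left h3 (by positivity)
      _ = C₀ * Real.exp (L * d w) := by rw [hC₀]; ring
  -- Step 2: Chebyshev, `ν(S) ≤ 1/A`
  have hνS : ν.real S ≤ 1 / A := by
    have hf2 : Measurable fun w ↦ (h t₁).edist (hR t₁) z₁ w ^ 2 :=
      ((ENNReal.continuous_pow 2).comp hcont).measurable
    have hmarkov := mul_meas_ge_le_lintegral₀ (μ := ν) hf2.aemeasurable (ENNReal.ofReal (r₀ ^ 2))
    have hsub : S ⊆ {w | ENNReal.ofReal (r₀ ^ 2) ≤ (h t₁).edist (hR t₁) z₁ w ^ 2} := by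
      intro w hw
      have hw' : ENNReal.ofReal r₀ ≤ (h t₁).edist (hR t₁) z₁ w := hw
      rw [mem_setOf_eq, ENNReal.ofReal_pow hr₀0]
      exact pow_le_pow_left' hw' 2
    have h1 : ENNReal.ofReal (r₀ ^ 2) * ν S ≤ ENNReal.ofReal (Hm * (t - t₁)) :=
      (mul_le_mul_right (measure_mono hsub) _).trans (hmarkov.trans hvar)
    rw [hr₀2] at h1
    have h2 : ν S ≤ ENNReal.ofReal (Hm * (t - t₁)) / ENNReal.ofReal (A * (Hm * (t - t₁))) := by
      refine (ENNReal.le_div_iff_mul_le (Or.inl ?_) (Or.inl ENNReal.ofReal_ne_top)).2 ?_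
      · exact (ENNReal.ofReal_pos.2 (mul_pos hA0 hV0)).ne'
      · rw [mul_comm]; exact h1
    rw [← ENNReal.ofReal_div_of_pos (mul_pos hA0 hV0), mul_comm A _, ← div_div,
      div_self hV0.ne'] at h2
    rw [measureReal_def]
    calc (ν S).toReal ≤ (ENNReal.ofReal (1 / A)).toReal :=
          ENNReal.toReal_mono ENNReal.ofReal_ne_top h2
      _ = 1 / A := ENNReal.toReal_ofReal (by positivity)
  -- Step 3: the exponential moment bound, `∫ e^{2Ld} dν ≤ 3 e^{2E}`
  have hE2 : 8 * (2 * L) ^ 2 * (t - t₁) + 2 * L * Real.sqrt (2 * (Hm * (t - t₁))) = 2 * E := by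
    rw [hE, htt₁]
    have h1 : Real.sqrt (2 * (Hm * (ρ ^ 2 * τ))) = Real.sqrt (2 * Hm) * ρ * Real.sqrt τ := by
      rw [show 2 * (Hm * (ρ ^ 2 * τ)) = 2 * Hm * ρ ^ 2 * τ by ring,
        Real.sqrt_mul (by positivity : (0 : ℝ) ≤ 2 * Hm * ρ ^ 2) τ,
        Real.sqrt_mul (by positivity : (0 : ℝ) ≤ 2 * Hm) (ρ ^ 2), Real.sqrt_sq hρ.le]
    rw [h1]
    simp only [mul_pow, Real.sq_sqrt hτ.le]
    ring
  have hmom : ∫ w, Real.exp (2 * L * d w) ∂ν ≤ 3 * Real.exp (2 * E) := by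
    refine hmom₀.trans_eq ?_
    rw [hE2]
  have hexp2E : Real.exp (2 * E) = Real.exp E ^ 2 := by
    rw [sq, ← Real.exp_add, two_mul]
  -- Step 4: AM–GM with `λ = A p e^{E}`, `∫_S e^{Ld} dν ≤ p e^{E}`
  have hlam : 0 < A * p * Real.exp E := by positivity
  have hIS : ∫ w in S, Real.exp (L * d w) ∂ν ≤ p * Real.exp E := by
    have hI2 : ∫ w in S, Real.exp (2 * L * d w) ∂ν ≤ 3 * Real.exp (2 * E) :=
      (setIntegral_le_integral (hint hde2)
        (Eventually.of_forall fun w ↦ (Real.exp_pos _).le)).trans hmom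
    have hamgm : ∀ w, Real.exp (L * d w) ≤
        A * p * Real.exp E / 2 + Real.exp (2 * L * d w) / (2 * (A * p * Real.exp E)) := by
      intro w
      have hsq : Real.exp (2 * L * d w) = Real.exp (L * d w) ^ 2 := by
        rw [sq, ← Real.exp_add]
        ring_nf
      rw [hsq]
      exact le_half_add_sq_div hlam
    have hci : Integrable (fun w ↦ A * p * Real.exp E / 2 +
        Real.exp (2 * L * d w) / (2 * (A * p * Real.exp E))) ν :=
      (integrable_const _).add ((hint hde2).div_const _)
    calc ∫ w in S, Real.exp (L * d w) ∂ν
        ≤ ∫ w in S, (A * p * Real.exp E / 2 +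
            Real.exp (2 * L * d w) / (2 * (A * p * Real.exp E))) ∂ν :=
          setIntegral_mono (hint hde).integrableOn hci.integrableOn hamgm
      _ = A * p * Real.exp E / 2 * ν.real S +
            1 / (2 * (A * p * Real.exp E)) * ∫ w in S, Real.exp (2 * L * d w) ∂ν := by
          rw [integral_add (integrable_const _) ((hint hde2).div_const _).integrableOn,
            setIntegral_const, smul_eq_mul, integral_div]
          ring
      _ ≤ A * p * Real.exp E / 2 * (1 / A) +
            1 / (2 * (A * p * Real.exp E)) * (3 * Real.exp (2 * E)) :=
          add_le_add (mul_le_mul_of_nonneg_left hνS (by positivity))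
            (mul_le_mul_of_nonneg_left hI2 (by positivity))
      _ = p * Real.exp E := by
          rw [hexp2E]
          exact tail_amgm_const hAne hp.ne' (Real.exp_pos E).ne' hp2
  -- Step 5: assemble
  calc ∫ w in S, hflow.heatKernelFn hh hR t₁ w (y, s) ∂ν
      ≤ ∫ w in S, C₀ * Real.exp (L * d w) ∂ν :=
        integral_mono_of_nonneg (Eventually.of_forall fun w ↦ (hupos w).le)
          (hint (continuous_const.mul hde)).integrableOn (Eventually.of_forall hpt)
    _ = C₀ * ∫ w in S, Real.exp (L * d w) ∂ν := integral_const_mul _ _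
    _ ≤ C₀ * (p * Real.exp E) := mul_le_mul_of_nonneg_left hIS hC₀0
    _ = _ := by rw [hC₀, Real.mul_rpow h1ρ.le hτ.le]; ring

end BootstrapTail

end Literature.Geometry.Riemannian

end
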